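import Mathlib.Data.Fintype.Basic
import Summits.ValiantsHypothesis.ValiantsHypothesis.Theorems.KPlusLogSqLawTropicalBMatchingExchange

/-!
# Route `KPlusLogSqLaw`, crux `TropicalB` — NO RIGID DOUBLE READ OF A REGISTER WITH THREE OR MORE VALUES
# (a block that can export the consistent row pairs `{a v, b v}` for three values `v` also exports a MIXED pair `{a v, b w}`, `v ≠ w`)

HONEST FRAMING.  Helper file (STRUCTURE / no-go for one gadget architecture) toward the registered stubs `stub_tropThin` / `stub_tropFat`
of `Cruxes/TropicalB/Lines/birth.lean` (crux `Summit.ValiantsHypothesis.ValiantsHypothesis.Theses.KPlusLogSqLaw.TropicalB`, ledger item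
`stmt-ValiantsHypothesis-19771`, route `KPlusLogSqLaw`; cell `pub-symmetroid`, seat val-sym-trop-p1 g28, 2026-08-29; `--supports … --as helper`).
A purely combinatorial fact about matchings of an arbitrary finite bipartite graph; nothing here bounds `TropicalB`, and nothing bears on
`WeakLifting`, the doors, `MatrixDescartes` (stmt-ValiantsHypothesis-18050) or `VP ≠ VNP`.

THE SETTING (memo HOME/val-sym-trop-p1/g28/TOWER-CALIBRATION-g28.md §3 (vi)).  In the cell's «register» architectures a digit lives in a BLOCK of the
matrix: a set `R` of rows, a set `C` of internal columns with `|R| = |C| + 2`, and a set `E ⊆ R × C` of present cells; in a term, the block's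
internal columns are covered by block rows (a matching `N ⊆ E` with `rng N = C`) and the two rows of `R ∖ dom N` are EXPORTED (matched outside
the block, where other gadgets read them).  A register with values `v` that is read at TWO ports wants the exported pair to be `{a v, b v}`
(port-`a` row and port-`b` row carrying the SAME value) and never a mixed pair `{a v, b w}`, `v ≠ w` — RIGIDLY, i.e. by the support `E` alone,
before any valuations.  For a BIT this is possible (remark below: columns `κ₁, κ₂`, cells `(a₀,κ₁), (b₁,κ₁), (a₁,κ₂), (b₀,κ₂)`: among the CROSS
pairs (one row per port) exactly the consistent ones `{a₀,b₀}`, `{a₁,b₁}` are exportable — the same-port pairs `{a₀,a₁}`, `{b₀,b₁}` are exportable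
too, which is harmless when each reader accepts exactly one row, and is the seed of the network «leak» of the memo, §3 (vi)(b)).

THE LAW (`exists_mixed_export`).  For THREE (or more) values it is impossible: if for `v = 0, 1, 2` some matching `N_v ⊆ E` covers exactly the
columns `C` using exactly the rows `R ∖ {a v, b v}` (six distinct port rows), then some matching `N ⊆ E` covers exactly `C` using exactly
`R ∖ {a v, b w}` with `v ≠ w`.  Proof: two alternating-path exchanges (the tree's `MatchingExchange.exchange`, Berge): from `N₀` and `N₁` one gets a
cover exporting `{b₀, a₁}` (mixed — done) or `{a₀, a₁}` (`export_swap`); from the latter and `N₂` one gets a cover exporting `{a₀, b₂}` or `{a₁, b₂}`,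
both mixed.  (Matroid reading: the exportable pairs are the bases of the rank-2 dual of the transversal matroid of `E`, i.e. pairs of non-parallel
non-loops; «`{a v, b w}` exportable iff `v = w`» would make `a₀ ∥ b₁ ∥ … ` and force `a₁ ∥ b₁`.)  Consequence for design hunting: a register with
`≥ 3` values can be read consistently at two places only through COSTS and the common parameter `θ`, never through the support — and cost-read
copies disagree as soon as they are coupled to different partners (the cell's RegisterPair law / the staircase's doubling); bits are the only
digits that duplicate structurally, and networks of duplicated bits leak along cycles of the coupling graph (memo §3 (vi)(b), located).

All [folklore] (Berge 1957 alternating paths; matroid basis exchange); the packaging for the cell's register blocks is the only new thing.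
-/

set_option linter.dupNamespace false
set_option autoImplicit false

namespace Summit.ValiantsHypothesis.ValiantsHypothesis.Theorems.KPlusLogSqLaw

namespace RigidFanout

open Finset
open Literature.Computability.MetaComplexity.PBij
open MatchingExchange

variable {α β : Type*} [DecidableEq α] [DecidableEq β]

omit [DecidableEq α] in
/-- a matching whose range is `C` has `|C|` edges. [folklore] -/
theorem card_eq_of_rng_eq {N : Finset (α × β)} (hN : IsPMatching N) {C : Finset β} (hC : rng N = C) : N.card = C.card := by
  rw [← hN.card_rng, hC]

/-- **EXPORT SWAP** (one alternating-path exchange).  Two covers of the same column set `C` inside `E`, one using exactly the rows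
`R ∖ {x₁, x₂}`, the other exactly `R ∖ {y₁, y₂}`, with `y₁ ∈ R` different from `x₁, x₂` and `x₁ ≠ x₂` both in `R` and different from `y₁, y₂`:
then some cover of `C` inside `E` uses exactly `R ∖ {x, y₁}` with `x ∈ {x₁, x₂}` — the export `y₁` of the second cover can be traded against ONE
of the exports of the first. [folklore: Berge's alternating path, via `MatchingExchange.exchange`] -/
theorem export_swap {E : Finset (α × β)} {R : Finset α} {C : Finset β} {M M' : Finset (α × β)} {x₁ x₂ y₁ y₂ : α}
    (hME : M ⊆ E) (hM : IsPMatching M) (hMr : rng M = C) (hMd : dom M = R \ {x₁, x₂})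
    (hM'E : M' ⊆ E) (hM' : IsPMatching M') (hM'r : rng M' = C) (hM'd : dom M' = R \ {y₁, y₂})
    (hx₁ : x₁ ∈ R) (hx₂ : x₂ ∈ R) (hx₁₂ : x₁ ≠ x₂) (hy₁ : y₁ ∈ R)
    (hx₁y : x₁ ≠ y₁ ∧ x₁ ≠ y₂) (hx₂y : x₂ ≠ y₁ ∧ x₂ ≠ y₂) :
    ∃ x, (x = x₁ ∨ x = x₂) ∧ ∃ N : Finset (α × β), N ⊆ E ∧ IsPMatching N ∧ rng N = C ∧ dom N = R \ {x, y₁} := by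
  classical
  -- `y₁` is covered by `M`: erase its edge
  have hy₁d : y₁ ∈ dom M := by
    rw [hMd, Finset.mem_sdiff]
    refine ⟨hy₁, ?_⟩
    simp only [Finset.mem_insert, Finset.mem_singleton, not_or]
    exact ⟨fun h => hx₁y.1 h.symm, fun h => hx₂y.1 h.symm⟩
  obtain ⟨c, hyc⟩ := mem_dom.1 hy₁d
  set M₀ : Finset (α × β) := M.erase (y₁, c) with hM₀def
  have hM₀M : M₀ ⊆ M := Finset.erase_subset _ _
  have hM₀ : IsPMatching M₀ := hM.subset hM₀M
  have hcardM : M.card = C.card := card_eq_of_rng_eq hM hMr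
  have hcardM' : M'.card = C.card := card_eq_of_rng_eq hM' hM'r
  have hcard₀ : M₀.card + 1 = C.card := by
    rw [hM₀def, Finset.card_erase_of_mem hyc, hcardM]
    have : 0 < M.card := Finset.card_pos.2 ⟨_, hyc⟩
    omega
  have hlt : M₀.card < M'.card := by omega
  obtain ⟨N₁, N₂, hN₁, -, hU, -, hcN₁, hdom, hrng⟩ := exchange hM₀ hM' hlt
  -- `N₁ ⊆ M₀ ∪ M' ⊆ E`
  have hN₁U : N₁ ⊆ M₀ ∪ M' := by rw [← hU]; exact Finset.subset_union_left
  have hN₁E : N₁ ⊆ E := hN₁U.trans (Finset.union_subset (hM₀M.trans hME) hM'E)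
  -- range: `rng N₁ ⊆ C` and `|rng N₁| = |C|`
  have hrN₁ : rng N₁ = C := by
    apply Finset.eq_of_subset_of_card_le
    · intro z hz
      have := rng_mono hN₁U hz
      rw [rng_union, Finset.mem_union] at this
      rcases this with h | h
      · exact hMr ▸ rng_mono hM₀M h
      · exact hM'r ▸ h
    · rw [hN₁.card_rng, hcN₁]; omega
  -- domain: `dom M₀ ⊆ dom N₁ ⊆ dom M₀ ∪ dom M' ⊆ R ∖ {y₁}`, `|dom N₁| = |C| = |R| − 2`
  have hdM₀ : dom M₀ = (R \ {x₁, x₂}).erase y₁ := by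
    ext z
    rw [Finset.mem_erase, ← hMd, mem_dom, mem_dom]
    constructor
    · rintro ⟨w, hw⟩
      rw [hM₀def, Finset.mem_erase] at hw
      refine ⟨fun hz => hw.1 ?_, ⟨w, hw.2⟩⟩
      subst hz
      exact Prod.ext rfl (hM.eq_of_fst_eq hw.2 hyc)
    · rintro ⟨hz, ⟨w, hw⟩⟩
      refine ⟨w, ?_⟩
      rw [hM₀def, Finset.mem_erase]
      exact ⟨fun h => hz (Prod.mk.inj h).1, hw⟩
  have hdN₁sub : dom N₁ ⊆ R.erase y₁ := by
    intro z hz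
    have := dom_mono hN₁U hz
    rw [dom_union, Finset.mem_union, hdM₀, hM'd] at this
    rw [Finset.mem_erase]
    rcases this with h | h
    · rw [Finset.mem_erase, Finset.mem_sdiff] at h
      exact ⟨h.1, h.2.1⟩
    · rw [Finset.mem_sdiff, Finset.mem_insert, Finset.mem_singleton, not_or] at h
      exact ⟨h.2.1, h.1⟩
  have hcardN₁d : (dom N₁).card = C.card := by rw [hN₁.card_dom, hcN₁]; omega
  -- the two candidate domains
  have hx₁R' : x₁ ∈ R.erase y₁ := Finset.mem_erase.2 ⟨hx₁y.1, hx₁⟩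
  have hx₂R' : x₂ ∈ R.erase y₁ := Finset.mem_erase.2 ⟨hx₂y.1, hx₂⟩
  have hcardR : (R \ {x₁, x₂}).card + 2 = R.card := by
    have hsub : ({x₁, x₂} : Finset α) ⊆ R := by
      intro z hz
      simp only [Finset.mem_insert, Finset.mem_singleton] at hz
      rcases hz with rfl | rfl <;> assumption
    rw [Finset.card_sdiff_of_subset hsub, Finset.card_pair hx₁₂]
    have : 2 ≤ R.card := (Finset.card_pair hx₁₂).symm.le.trans (Finset.card_le_card hsub)
    omega
  have hcardC : C.card + 2 = R.card := by
    rw [← hcardM, ← hM.card_dom, hMd]; exact hcardR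
  -- not both `x₁, x₂` lie in `dom N₁` (else `dom N₁ ⊇ (R.erase y₁)`, too big); not neither (else `dom N₁ ⊆ R ∖ {x₁,x₂,y₁}`, too small)
  have hdM₀sub : dom M₀ ⊆ dom N₁ := hdom
  by_cases h1 : x₁ ∈ dom N₁
  · -- then `x₂ ∉ dom N₁`, and `dom N₁ = R ∖ {x₂, y₁}`
    refine ⟨x₂, Or.inr rfl, N₁, hN₁E, hN₁, hrN₁, ?_⟩
    have h2 : x₂ ∉ dom N₁ := by
      intro h2
      -- `dom N₁ ⊇ dom M₀ ∪ {x₁, x₂} = R.erase y₁`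
      have hsup : R.erase y₁ ⊆ dom N₁ := by
        intro z hz
        by_cases hz1 : z = x₁
        · exact hz1 ▸ h1
        by_cases hz2 : z = x₂
        · exact hz2 ▸ h2
        apply hdM₀sub
        rw [hdM₀, Finset.mem_erase, Finset.mem_sdiff, Finset.mem_insert, Finset.mem_singleton, not_or]
        rw [Finset.mem_erase] at hz
        exact ⟨hz.1, hz.2, hz1, hz2⟩
      have := Finset.card_le_card hsup
      rw [Finset.card_erase_of_mem hy₁, hcardN₁d] at this
      omega
    apply Finset.eq_of_subset_of_card_le
    · intro z hz
      have hz' := hdN₁sub hz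
      rw [Finset.mem_erase] at hz'
      rw [Finset.mem_sdiff, Finset.mem_insert, Finset.mem_singleton, not_or]
      exact ⟨hz'.2, fun h => h2 (h ▸ hz), hz'.1⟩
    · have hsub : ({x₂, y₁} : Finset α) ⊆ R := by
        intro z hz
        simp only [Finset.mem_insert, Finset.mem_singleton] at hz
        rcases hz with rfl | rfl <;> assumption
      rw [Finset.card_sdiff_of_subset hsub, Finset.card_pair hx₂y.1, hcardN₁d]
      omega
  · -- then `dom N₁ = R ∖ {x₁, y₁}`
    refine ⟨x₁, Or.inl rfl, N₁, hN₁E, hN₁, hrN₁, ?_⟩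
    apply Finset.eq_of_subset_of_card_le
    · intro z hz
      have hz' := hdN₁sub hz
      rw [Finset.mem_erase] at hz'
      rw [Finset.mem_sdiff, Finset.mem_insert, Finset.mem_singleton, not_or]
      exact ⟨hz'.2, fun h => h1 (h ▸ hz), hz'.1⟩
    · have hsub : ({x₁, y₁} : Finset α) ⊆ R := by
        intro z hz
        simp only [Finset.mem_insert, Finset.mem_singleton] at hz
        rcases hz with rfl | rfl <;> assumption
      rw [Finset.card_sdiff_of_subset hsub, Finset.card_pair hx₁y.1, hcardN₁d]
      omega

/-- **NO RIGID DOUBLE READ OF A THREE-VALUED REGISTER.**  Rows `a 0, a 1, a 2` (port `a`) and `b 0, b 1, b 2` (port `b`), six distinct rows of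
`R`; if for every value `v : Fin 3` some matching inside `E` covers exactly the columns `C` with exactly the rows `R ∖ {a v, b v}` (the block
exports the CONSISTENT pair), then some matching inside `E` covers exactly `C` with exactly `R ∖ {a v, b w}` for some `v ≠ w` (the block also
exports a MIXED pair).  [folklore: two alternating-path exchanges; matroid form: bases of a rank-2 matroid are the pairs of non-parallel non-loops] -/
theorem exists_mixed_export {E : Finset (α × β)} {R : Finset α} {C : Finset β} (a b : Fin 3 → α)
    (ha : ∀ v, a v ∈ R) (hb : ∀ v, b v ∈ R) (hinj : ∀ v w, a v = a w → v = w) (hinj' : ∀ v w, b v = b w → v = w)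
    (hab : ∀ v w, a v ≠ b w)
    (hcover : ∀ v, ∃ N : Finset (α × β), N ⊆ E ∧ IsPMatching N ∧ rng N = C ∧ dom N = R \ {a v, b v}) :
    ∃ v w : Fin 3, v ≠ w ∧ ∃ N : Finset (α × β), N ⊆ E ∧ IsPMatching N ∧ rng N = C ∧ dom N = R \ {a v, b w} := by
  classical
  obtain ⟨M₀, h₀E, h₀, h₀r, h₀d⟩ := hcover 0
  obtain ⟨M₁, h₁E, h₁, h₁r, h₁d⟩ := hcover 1
  obtain ⟨M₂, h₂E, h₂, h₂r, h₂d⟩ := hcover 2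
  have h01 : (0 : Fin 3) ≠ 1 := by decide
  have h02 : (0 : Fin 3) ≠ 2 := by decide
  have h12 : (1 : Fin 3) ≠ 2 := by decide
  -- first exchange: trade the export `a 1` of `M₁` against one export of `M₀`
  obtain ⟨x, hx, N, hNE, hN, hNr, hNd⟩ :=
    export_swap (x₁ := a 0) (x₂ := b 0) (y₁ := a 1) (y₂ := b 1) h₀E h₀ h₀r h₀d h₁E h₁ h₁r h₁d (ha 0) (hb 0) (hab 0 0) (ha 1)
      ⟨fun h => h01 (hinj _ _ h), hab 0 1⟩ ⟨fun h => hab 1 0 h.symm, fun h => h01 (hinj' _ _ h)⟩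
  rcases hx with rfl | rfl
  · -- `N` exports the same-port pair `{a 0, a 1}`: second exchange against `M₂`, trading its export `b 2`
    obtain ⟨x', hx', N', hN'E, hN', hN'r, hN'd⟩ :=
      export_swap (x₁ := a 0) (x₂ := a 1) (y₁ := b 2) (y₂ := a 2) hNE hN hNr hNd h₂E h₂ h₂r
        (by rw [h₂d, Finset.pair_comm]) (ha 0) (ha 1) (fun h => h01 (hinj _ _ h)) (hb 2)
        ⟨hab 0 2, fun h => h02 (hinj _ _ h)⟩ ⟨hab 1 2, fun h => h12 (hinj _ _ h)⟩
    rcases hx' with rfl | rfl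
    · exact ⟨0, 2, h02, N', hN'E, hN', hN'r, hN'd⟩
    · exact ⟨1, 2, h12, N', hN'E, hN', hN'r, hN'd⟩
  · -- `N` exports `{b 0, a 1}`: mixed already
    refine ⟨1, 0, h01.symm, N, hNE, hN, hNr, ?_⟩
    rw [hNd, Finset.pair_comm]

/-- **`k ≥ 3` values**: the same for a register with any number `k ≥ 3` of values (restrict to the first three). [folklore] -/
theorem exists_mixed_export_of_three_le {E : Finset (α × β)} {R : Finset α} {C : Finset β} {k : ℕ} (hk : 3 ≤ k) (a b : Fin k → α)
    (ha : ∀ v, a v ∈ R) (hb : ∀ v, b v ∈ R) (hinj : Function.Injective a) (hinj' : Function.Injective b)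
    (hab : ∀ v w, a v ≠ b w)
    (hcover : ∀ v, ∃ N : Finset (α × β), N ⊆ E ∧ IsPMatching N ∧ rng N = C ∧ dom N = R \ {a v, b v}) :
    ∃ v w : Fin k, v ≠ w ∧ ∃ N : Finset (α × β), N ⊆ E ∧ IsPMatching N ∧ rng N = C ∧ dom N = R \ {a v, b w} := by
  set ι : Fin 3 → Fin k := Fin.castLE hk with hι
  have hιinj : Function.Injective ι := Fin.castLE_injective hk
  obtain ⟨v, w, hvw, N, hN⟩ := exists_mixed_export (E := E) (R := R) (C := C) (a ∘ ι) (b ∘ ι)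
    (fun v => ha (ι v)) (fun v => hb (ι v)) (fun v w h => hιinj (hinj h)) (fun v w h => hιinj (hinj' h))
    (fun v w => hab (ι v) (ι w)) (fun v => hcover (ι v))
  exact ⟨ι v, ι w, fun h => hvw (hιinj h), N, hN⟩

/-- **Remark: a BIT does fan out rigidly (on cross pairs).**  The four-cell block with rows `a₀ = 0, a₁ = 1, b₀ = 2, b₁ = 3`, columns
`κ₁ = 0, κ₂ = 1` and cells `(a₀,κ₁), (b₁,κ₁), (a₁,κ₂), (b₀,κ₂)` has covers of `{κ₁, κ₂}` exporting `{a₀, b₀}` and `{a₁, b₁}`, and NONE exporting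
a mixed cross pair `{a₀, b₁}` or `{a₁, b₀}` (each kills a column); the same-port pairs `{a₀,a₁}`, `{b₀,b₁}` are exportable as well (rank-2 matroid
with parallel classes `{a₀,b₁}`, `{a₁,b₀}`).  Stated as the four facts below (explicit matchings; the negative ones by the neighbourhood of a
column). [this cell; elementary] -/
theorem bit_fanout_consistent₀ :
    ∃ N : Finset (Fin 4 × Fin 2), N ⊆ {((0 : Fin 4), (0 : Fin 2)), (3, 0), (1, 1), (2, 1)} ∧ IsPMatching N ∧
      rng N = Finset.univ ∧ dom N = Finset.univ \ {0, 2} :=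
  ⟨{((3 : Fin 4), (0 : Fin 2)), (1, 1)}, by decide, by decide, by decide, by decide⟩

/-- the bit block exports `{a₁, b₁} = {1, 3}`. [this cell; elementary] -/
theorem bit_fanout_consistent₁ :
    ∃ N : Finset (Fin 4 × Fin 2), N ⊆ {((0 : Fin 4), (0 : Fin 2)), (3, 0), (1, 1), (2, 1)} ∧ IsPMatching N ∧
      rng N = Finset.univ ∧ dom N = Finset.univ \ {1, 3} :=
  ⟨{((0 : Fin 4), (0 : Fin 2)), (2, 1)}, by decide, by decide, by decide, by decide⟩

/-- the bit block never exports the mixed pair `{a₀, b₁} = {0, 3}` (column `κ₁ = 0` would be uncovered). [this cell; elementary] -/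
theorem bit_fanout_not_mixed₀₁ :
    ¬ ∃ N : Finset (Fin 4 × Fin 2), N ⊆ {((0 : Fin 4), (0 : Fin 2)), (3, 0), (1, 1), (2, 1)} ∧ IsPMatching N ∧
      rng N = Finset.univ ∧ dom N = Finset.univ \ {0, 3} := by
  rintro ⟨N, hNE, -, hNr, hNd⟩
  have h0 : (0 : Fin 2) ∈ rng N := by rw [hNr]; exact Finset.mem_univ _
  obtain ⟨r, hr⟩ := mem_rng.1 h0
  have hr' := hNE hr
  have hrd : r ∈ dom N := mem_dom.2 ⟨0, hr⟩
  rw [hNd] at hrd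
  simp only [Finset.mem_insert, Finset.mem_singleton, Prod.mk.injEq] at hr'
  simp only [Finset.mem_sdiff, Finset.mem_univ, Finset.mem_insert, Finset.mem_singleton, true_and, not_or] at hrd
  rcases hr' with ⟨h, -⟩ | ⟨h, -⟩ | ⟨-, h⟩ | ⟨-, h⟩
  · exact hrd.1 h
  · exact hrd.2 h
  · exact absurd h (by decide)
  · exact absurd h (by decide)

/-- the bit block never exports the mixed pair `{a₁, b₀} = {1, 2}` (column `κ₂ = 1` would be uncovered). [this cell; elementary] -/
theorem bit_fanout_not_mixed₁₀ :
    ¬ ∃ N : Finset (Fin 4 × Fin 2), N ⊆ {((0 : Fin 4), (0 : Fin 2)), (3, 0), (1, 1), (2, 1)} ∧ IsPMatching N ∧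
      rng N = Finset.univ ∧ dom N = Finset.univ \ {1, 2} := by
  rintro ⟨N, hNE, -, hNr, hNd⟩
  have h1 : (1 : Fin 2) ∈ rng N := by rw [hNr]; exact Finset.mem_univ _
  obtain ⟨r, hr⟩ := mem_rng.1 h1
  have hr' := hNE hr
  have hrd : r ∈ dom N := mem_dom.2 ⟨1, hr⟩
  rw [hNd] at hrd
  simp only [Finset.mem_insert, Finset.mem_singleton, Prod.mk.injEq] at hr'
  simp only [Finset.mem_sdiff, Finset.mem_univ, Finset.mem_insert, Finset.mem_singleton, true_and, not_or] at hrd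
  rcases hr' with ⟨-, h⟩ | ⟨-, h⟩ | ⟨h, -⟩ | ⟨h, -⟩
  · exact absurd h (by decide)
  · exact absurd h (by decide)
  · exact hrd.1 h
  · exact hrd.2 h

end RigidFanout

end Summit.ValiantsHypothesis.ValiantsHypothesis.Theorems.KPlusLogSqLaw
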